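import Summits.AtomisticToContinuum.Crystallization.Theorems.FrustratedLawDichotomyAtlasReachTexturedNearFar
import Summits.AtomisticToContinuum.Crystallization.Theorems.FrustratedLawDichotomyRangeCut

/-!
# FrustratedLawDichotomy · crux `AperiodicFrustratedLawGap` (stmt-AtomisticToContinuum-27623) — K2″ RANGE CUT: the local frustration
# inequality split into a FINITE-WINDOW inequality for the truncated potential and a SITEWISE TAIL FLOOR, the tail floor PROVED
# (decomp-a2c, lens 5, generation 123)

LENS 5 «finite/base range + asymptotic regime + bridge» applied to the K2″ instrument of record, on the one lens-5 dial not yet turned on it —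
the INTERACTION RANGE.  (478) `…AtlasReachTextured.aperiodicFrustratedLawGap_of_texturedLocalGap` and (480) `…NearFar.…_nearFar` close the crux from
  (LFI)(r, g)   every rooted `7/10`-hard-core, Nash, TEXTURED configuration `μ` has `e⋆ + g ≤ symAvgEnergy r μ`
(split NEAR / FAR by `NearAffine ε₁ ρ`).  `symAvgEnergy r μ` is a convex combination of FULL Lennard-Jones site energies — infinite lattice sums — so no
finite object evaluates it.  This file cuts (LFI) at a truncation radius `R`:

  (LFI on a class K)(r, g)  ⟸  [FIN]  `TexturedWindowGapOn K r R (e⋆ + g + τ)` — the SAME convex combination (weights `symW`, atoms `T = B̄_r(0) ∩ S ∖ {0}`) of the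
                                     TRUNCATED site energies `rootEnergy (truncLJ R)` is `≥ e⋆ + g + τ` (`truncBallAvg`, §1) — a function of the finite set
                                     `S ∩ B̄(0, r + R)` (§7 `rootEnergy_truncLJ_eq_inter_ball` for the root term);
                             ∧ [TAIL] `SiteTailFloor R τ` — at every rooted `7/10`-hard-core configuration the far field `½ Σ_{|y| ≥ R} V_LJ(|y|)` is `≥ −τ`;
                             [BRIDGE] `texturedLocalGapOn_of_rangeCut` (PROVED, §3): convexity of the symmetric average + the tail floor spent once at the root
                                     and once at every re-rooted atom `θ_y μ` (`IsRootedHardCore.map_sub`).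
★ [TAIL] IS PROVED HERE at the sharp constant (§5 `siteTailFloorSharp`): `SiteTailFloor R (tauSharp R)` for every `R ≥ 1`,
`tauSharp R = ½·(4000/(1029 R³) + 500/(49 R⁴) + 2/(7 R⁵) + 1/(3 R⁶)) ≈ 1.944/R³` — the root energies' difference is half the Bochner integral of `V_LJ ∘ ‖·‖`
over `count|(S ∖ B(0,R))` (`integral_sub`, `integral_indicator`), that integral is the `tsum` over the countable far set (`setIntegral_countable`,
`…TransportPriceTail.countable_of_separated`), and the tree's `…FarFieldSharp.abs_tsum_field_le_of_far_sharp_sevenTenths` bounds it.  Hence the doors'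
only open hypotheses are FINITE-WINDOW inequalities: generic `aperiodicFrustratedLawGap_of_rangeCut` ((478), class `⊤`), `…_nearFar` ((480), INDEPENDENT
radii per branch) and the literal ★ `aperiodicFrustratedLawGap_of_rangeCut_nearFar_sharp`: crux ⟸ [FIN on `NearAffine ε₁ ρ`](r, 13, e⋆ + gN + 3/2000)
∧ [FIN off it](r, 7, e⋆ + gF + 1/100) (`tauSharp 13 ≤ 3/2000`, `tauSharp 7 ≤ 1/100` by `norm_num`).

TAGS (tribunal).  [FIN] UNDECIDED(test) · incomparable with the crux (pointwise, over ALL textured Nash hard-core configurations, stationary or not) · not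
implied by (LFI) (at threshold `e⋆ + g` it is — `V_LJ ≤ 0` beyond `1`, so truncation only raises site energies — but the bridge needs `e⋆ + g + τ`, and the
enemy's truncated average exceeds its full one only by ITS OWN tail `|t_μ(R)| < tauSharp R`) · leaf INSTRUMENTABLE-in-principle (reads `≈ 1.41·(4π/3)(r+R)³`
atoms) — SIZED: FAR `R_F = 7` ⇒ `≈ 3 100` atoms, NEAR `R_N = 13` ⇒ `≈ 13 000` atoms ⇒ IDEA-NEEDED (a unit decomposition INSIDE the window; not this lens's
dial).  [TAIL] WEAKER (texture-, Nash-, law-free consequence class) · KNOWN · ★ PROVED (§5).  [BRIDGE] PROVED (§3).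
SIZES (desk `num/tail_rc.py`, seconds; what must be small is the SLACK `tauSharp R − |t_enemy(R)|`, `|t_fcc(R)| ≈ (π√2/9)/R³ = 0.4935/R³`):
  R        4       5       6       7       8       10      12      13      16
  tauSharp 0.0505  0.0238  0.0130  0.0078  0.0050  0.0025  0.00137 0.00107 0.00055
  slack    0.0428  0.0198  0.0107  0.0064  0.0041  0.0020  0.00109 0.00083 0.00043
FAR (margin `gF ≈ 0.02–0.03`: TCP / icosahedral / Z14–16): `R_F = 7` (slack `0.0064 ≤ gF/3`).  NEAR (margin `gN ≈ 3.4·10⁻³` under the affine enemy at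
`κ_aff(fcc) = 4.45·10⁻³`): [FIN] bites iff slack `≤ κ_aff − gN ≈ 1.05·10⁻³` ⇒ `R_N = 13`.
WHY NOVEL (vs lens 1 tolerance bands, lens 2 E-doors / LP probe, lens 3 charts, lens 4 FirmGain, lens 6 number–phase sandwich, hands' caps / reach /
NEAR–FAR): none of them truncates the interaction; every pointwise certificate of (LFI) that anyone could run must, and the far-field price had been neither
typed in the K2″ currency nor sized against the K2″ margins.  The g33 range cut (`…RangeCut`, `…TailFloor*`) cuts the PERIODIC ENERGY functional of FINITE
clusters for the (EE)/(FDG) currency; this one cuts the SYMMETRIC SITE AVERAGE of infinite rooted configurations, re-rooted atom by atom, with the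
infinite-volume far field of `…FarFieldSharp`, and is class-generic (the NEAR and FAR radii differ by a factor 2).
WHY EACH OPEN PIECE IS STRICTLY WEAKER THAN WHAT IT REPLACES: [FIN] reads a finite window instead of the whole configuration and, at threshold `e⋆ + g`,
is a consequence of (LFI); it does not give (LFI) or the crux alone (it says nothing about `lennardJones` beyond `R`; the proved [TAIL] supplies that).
FINDING (memo NODE-g123.md §3): a POINTWISE certificate of NEAR through (480) is hostage to the far field — a proof that sees only the hard core beyond
`B_R` loses `≥ 1.05·10⁻³` unless `R ≥ 13`, and a far region denser than the window by the relative amount `d` beyond radius `r_w` shaves the root's average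
by `≈ 0.4935·d/r_w³` (`d = 0.2`, `r_w = 3` ⇒ `3.7·10⁻³ > gN`); so rigidity lemmas on `ρ ≲ 5`-balls cannot close NEAR pointwise at margin `3.4·10⁻³`.  At LAW
level the first-order far-field transfer cancels by stationarity (mass transport); NEAR belongs there (hand-2 #137 invariant-split doors + a law-level
tail lemma `E_P[t_R(root)] ≥ −A_R·E_P[m_root]`, the transport analogue of `…TailFloorSharp.tail_floor_of_farBound`).  FAR is certifiable pointwise with a
`B_8` window in principle (unit decomposition IDEA-NEEDED).  HONEST VERDICT: the range dial is NECESSARY (every certificate pays it; now paid on the tree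
side) and NOT SUFFICIENT (it finitises what each inequality reads, not the family of inequalities).
Plain `def`s (one functional, three `Prop`s, one constant); imports TREE (480) NearFar (hence (478), SymSharing, FarFieldSharp, TransportPriceTail) + g33
`…RangeCut` (`truncLJ`); no instance / notation / option; 0 sorry.  Tags: [new: junction], [new: bookkeeping], [folklore] (§5).
-/

noncomputable section

namespace Summit.AtomisticToContinuum.Crystallization.Theorems.FrustratedLawDichotomyLFIRangeCut

open MeasureTheory Metric Set
open scoped ENNReal BigOperators
open Literature.MathematicalPhysics.StatisticalMechanics Literature.Probability.Process
open Literature.Probability.Process.LocalConfig (finite_inter_of_separated)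
open Summit.AtomisticToContinuum.Crystallization.Theorems.ChargedEnergyGapNegative (E3 eStar)
open Summit.AtomisticToContinuum.Crystallization.Theorems.RepetitiveNetworkReductionRecurrentMember (ApprM NashM)
open Summit.AtomisticToContinuum.Crystallization.Theorems.FrustratedLawDichotomySymSharing
  (symW symPBall symAvgEnergy symAvgEnergy_eq_finsum sum_symW_toReal_le_one)
open Summit.AtomisticToContinuum.Crystallization.Theorems.FrustratedLawDichotomyRangeCut (truncLJ)
open Summit.AtomisticToContinuum.Crystallization.Theorems.FrustratedLawDichotomyFarFieldSharp (abs_tsum_field_le_of_far_sharp_sevenTenths)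
open Summit.AtomisticToContinuum.Crystallization.Theorems.FrustratedLawDichotomyTransportPriceTail
  (countable_of_separated integrable_lennardJones_of_isRootedHardCore)
open Summit.AtomisticToContinuum.Crystallization.Theorems.FrustratedLawDichotomyAtlasReachTextured (aperiodicFrustratedLawGap_of_texturedLocalGap)
open Summit.AtomisticToContinuum.Crystallization.Theorems.FrustratedLawDichotomyAtlasReachTexturedNearFar
  (NearAffine aperiodicFrustratedLawGap_of_texturedLocalGap_nearFar)

/-! ## §1. The finite-window functional: the symmetric average of TRUNCATED site energies, in legible form -/

/-- **TRUNCATED SYMMETRIC BALL AVERAGE** (legible form, on `count|S` with the atom list `T = B̄_r(0) ∩ S ∖ {0}`):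
`t_R(0)·(1 − Σ_{y∈T} w(y)) + Σ_{y∈T} w(y)·t_R(y)`, where `w = symW r (count|S)` are the symmetric weights of (473) `symAvgEnergy_eq_finsum` VERBATIM and
`t_R(y) = rootEnergy (truncLJ R) (θ_y count|S)` is the site energy of `y` with the pair potential cut at range `R` (g33 `…RangeCut.truncLJ`).  It is
`symAvgEnergy_eq_finsum`'s right-hand side with `lennardJones ↦ truncLJ R`, hence a function of `S ∩ B̄(0, max (2r) (r + R))` alone. [new: functional] -/
def truncBallAvg (R r : ℝ) (S : Set E3) (T : Finset E3) : ℝ :=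
  rootEnergy (truncLJ R) ((Measure.count : Measure E3).restrict S) *
      (1 - ∑ y ∈ T, (symW r ((Measure.count : Measure E3).restrict S) y).toReal) +
    ∑ y ∈ T, (symW r ((Measure.count : Measure E3).restrict S) y).toReal *
      rootEnergy (truncLJ R) (((Measure.count : Measure E3).restrict S).map fun z : E3 => z - y)

/-! ## §2. The pieces -/

/-- **[FIN] THE FINITE-WINDOW INEQUALITY on the class `K`** (`K = ⊤`, `NearAffine ε₁ ρ`, its negation, …): for every rooted `7/10`-separated `S ∋ 0` whose
rooted counting measure is Nash, TEXTURED (`∃ R₇ R₈ R₉, ApprM …` — the crux's clause (d), as in every (478)/(480) slot) and in `K`, the truncated symmetric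
average over the atom list `T` of `B̄_r(0) ∖ {0}` is `≥ a`.  Used at `a = e⋆ + g + tauSharp R`.  UNDECIDED(test); finite-dimensional in what it READS (the
window `S ∩ B̄(0, r + R)`), not in what it ASSUMES (Nash / texture / `K` are global — replace them by window-local necessary conditions when certifying). [new: piece] -/
def TexturedWindowGapOn (K : Measure E3 → Prop) (r R a : ℝ) : Prop :=
  ∀ S : Set E3, (0 : E3) ∈ S → (∀ x ∈ S, ∀ y ∈ S, x ≠ y → (7 / 10 : ℝ) ≤ dist x y) →
    NashM ((Measure.count : Measure E3).restrict S) → (∃ R₇ R₈ R₉ : ℝ, ApprM ((Measure.count : Measure E3).restrict S) R₇ R₈ R₉) →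
    K ((Measure.count : Measure E3).restrict S) →
    ∀ T : Finset E3, (T : Set E3) = symPBall r ∩ S → a ≤ truncBallAvg R r S T

/-- **[TAIL] THE SITEWISE TAIL FLOOR**: at every rooted `7/10`-hard-core configuration `ν`, cutting the potential at range `R` raises the root's site energy by
at most `τ`: `rootEnergy (truncLJ R) ν − τ ≤ rootEnergy lennardJones ν` (i.e. the far field `½ Σ_{|y| ≥ R} V_LJ(|y|)` is `≥ −τ`).  Texture-free, Nash-free,
law-free: WEAKER · KNOWN · PROVED at `τ = tauSharp R`, `R ≥ 1` (§5). [new: piece] -/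
def SiteTailFloor (R τ : ℝ) : Prop :=
  ∀ ν : Measure E3, IsRootedHardCore (7 / 10) ν → rootEnergy (truncLJ R) ν - τ ≤ rootEnergy lennardJones ν

/-- **THE SHARP TAIL CONSTANT** `tauSharp R = ½·(4000/(1029 R³) + 500/(49 R⁴) + 2/(7 R⁵) + 1/(3 R⁶))` — half the right-hand side of the tree's
`…FarFieldSharp.abs_tsum_field_le_of_far_sharp_sevenTenths` (the site energy is half the field sum).  `≈ 1.944/R³`. [new: constant] -/
def tauSharp (R : ℝ) : ℝ := 1 / 2 * (4000 / 1029 * R⁻¹ ^ 3 + 500 / 49 * R⁻¹ ^ 4 + 2 / 7 * R⁻¹ ^ 5 + 1 / 3 * R⁻¹ ^ 6)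

/-- **[TAIL♯]**: `SiteTailFloor R (tauSharp R)` for every `R ≥ 1` — PROVED (§5 `siteTailFloorSharp`). [new: piece] -/
def SiteTailFloorSharp : Prop := ∀ R : ℝ, 1 ≤ R → SiteTailFloor R (tauSharp R)

/-! ## §3. The bridge (proved): convexity of the symmetric average + the tail floor at every averaged atom -/

/-- **KERNEL, legible form**: on `count|S` (`0 ∈ S`, `7/10`-separated, atom list `T`), a floor `a ≤ truncBallAvg R r S T` and the tail floor `SiteTailFloor R τ`
give `a − τ ≤ symAvgEnergy r (count|S)` — the tail floor is spent once at the root and once at each re-rooted atom `θ_y (count|S)`, `y ∈ T`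
(`IsRootedHardCore.map_sub`), and the weights are a sub-convex combination (`sum_symW_toReal_le_one`). [new: bookkeeping] -/
theorem symAvgEnergy_ge_of_truncBallAvg {r R τ a : ℝ} (hr : 0 < r) (hTF : SiteTailFloor R τ) {S : Set E3} (h0S : (0 : E3) ∈ S)
    (hsep : ∀ x ∈ S, ∀ y ∈ S, x ≠ y → (7 / 10 : ℝ) ≤ dist x y) (T : Finset E3) (hT : (T : Set E3) = symPBall r ∩ S)
    (ha : a ≤ truncBallAvg R r S T) : a - τ ≤ symAvgEnergy r ((Measure.count : Measure E3).restrict S) := by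
  have hμ : IsRootedHardCore (7 / 10) ((Measure.count : Measure E3).restrict S) := ⟨S, h0S, hsep, rfl⟩
  have hs := sum_symW_toReal_le_one hr h0S hsep T hT
  have hW0 : ∀ y ∈ T, 0 ≤ (symW r ((Measure.count : Measure E3).restrict S) y).toReal := fun _ _ => ENNReal.toReal_nonneg
  have h0 := hTF _ hμ
  have hy : ∀ y ∈ T, rootEnergy (truncLJ R) (((Measure.count : Measure E3).restrict S).map fun z : E3 => z - y) - τ ≤
      rootEnergy lennardJones (((Measure.count : Measure E3).restrict S).map fun z : E3 => z - y) := fun y hyT => by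
    have hyS : (y : E3) ∈ (T : Set E3) := Finset.mem_coe.mpr hyT
    rw [hT] at hyS
    exact hTF _ (hμ.map_sub ((count_restrict_singleton_ne_zero_iff S y).mpr hyS.2))
  rw [symAvgEnergy_eq_finsum hr h0S hsep T hT]
  unfold truncBallAvg at ha
  have h1 : (rootEnergy (truncLJ R) ((Measure.count : Measure E3).restrict S) - τ) *
        (1 - ∑ y ∈ T, (symW r ((Measure.count : Measure E3).restrict S) y).toReal) ≤
      rootEnergy lennardJones ((Measure.count : Measure E3).restrict S) *
        (1 - ∑ y ∈ T, (symW r ((Measure.count : Measure E3).restrict S) y).toReal) :=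
    mul_le_mul_of_nonneg_right h0 (sub_nonneg.mpr hs)
  have h2 : ∑ y ∈ T, (symW r ((Measure.count : Measure E3).restrict S) y).toReal *
        (rootEnergy (truncLJ R) (((Measure.count : Measure E3).restrict S).map fun z : E3 => z - y) - τ) ≤
      ∑ y ∈ T, (symW r ((Measure.count : Measure E3).restrict S) y).toReal *
        rootEnergy lennardJones (((Measure.count : Measure E3).restrict S).map fun z : E3 => z - y) :=
    Finset.sum_le_sum fun y hyT => mul_le_mul_of_nonneg_left (hy y hyT) (hW0 y hyT)
  have h3 : ∑ y ∈ T, (symW r ((Measure.count : Measure E3).restrict S) y).toReal *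
        (rootEnergy (truncLJ R) (((Measure.count : Measure E3).restrict S).map fun z : E3 => z - y) - τ) =
      ∑ y ∈ T, (symW r ((Measure.count : Measure E3).restrict S) y).toReal *
          rootEnergy (truncLJ R) (((Measure.count : Measure E3).restrict S).map fun z : E3 => z - y) -
        τ * ∑ y ∈ T, (symW r ((Measure.count : Measure E3).restrict S) y).toReal := by
    rw [Finset.mul_sum, ← Finset.sum_sub_distrib]
    exact Finset.sum_congr rfl fun y _ => by ring
  linarith

/-- ★ **THE BRIDGE**: [FIN] on the class `K` at threshold `e⋆ + g + τ` ∧ [TAIL] `SiteTailFloor R τ` ⟹ the local frustration inequality (LFI)(r, g) restricted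
to `K`, in EXACTLY the slot shape of (478)/(480) (`IsRootedHardCore (7/10) μ → NashM μ → (∃ R₇ R₈ R₉, ApprM μ R₇ R₈ R₉) → K μ → e⋆ + g ≤ symAvgEnergy r μ`).
The atom list `T` is produced from the hard core (`finite_inter_of_separated`). [new: junction] -/
theorem texturedLocalGapOn_of_rangeCut {K : Measure E3 → Prop} {r R τ g : ℝ} (hr : 0 < r)
    (hW : TexturedWindowGapOn K r R (eStar + g + τ)) (hT : SiteTailFloor R τ) :
    ∀ μ : Measure E3, IsRootedHardCore (7 / 10) μ → NashM μ → (∃ R₇ R₈ R₉ : ℝ, ApprM μ R₇ R₈ R₉) → K μ →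
      eStar + g ≤ symAvgEnergy r μ := by
  intro μ hμ hN hA hK
  obtain ⟨S, h0S, hsep, rfl⟩ := hμ
  have hfin : (symPBall r ∩ S).Finite :=
    (finite_inter_of_separated (by norm_num : (0 : ℝ) < 7 / 10) hsep (isCompact_closedBall (0 : E3) r)).subset
      fun y hy => ⟨hy.1.1, hy.2⟩
  have hTS : (hfin.toFinset : Set E3) = symPBall r ∩ S := hfin.coe_toFinset
  have h := symAvgEnergy_ge_of_truncBallAvg hr hT h0S hsep hfin.toFinset hTS (hW S h0S hsep hN hA hK hfin.toFinset hTS)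
  linarith

/-- ★ **THE RANGE-CUT DOOR** (class `K = ⊤`, through (478) `aperiodicFrustratedLawGap_of_texturedLocalGap`): [FIN](r, R, e⋆ + g + τ) ∧ [TAIL](R, τ), `g > 0`
⟹ `AperiodicFrustratedLawGap` BY NAME. [new: junction] -/
theorem aperiodicFrustratedLawGap_of_rangeCut {r R τ g : ℝ} (hr : 0 < r) (hg : 0 < g)
    (hW : TexturedWindowGapOn (fun _ => True) r R (eStar + g + τ)) (hT : SiteTailFloor R τ) :
    Summit.AtomisticToContinuum.Crystallization.Theses.FrustratedLawDichotomy.AperiodicFrustratedLawGap :=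
  aperiodicFrustratedLawGap_of_texturedLocalGap hr hg fun μ hμ hN hA =>
    texturedLocalGapOn_of_rangeCut hr hW hT μ hμ hN hA trivial

/-- ★ **THE RANGE-CUT DOOR, NEAR / FAR** (through (480) `aperiodicFrustratedLawGap_of_texturedLocalGap_nearFar`), with INDEPENDENT truncation radii and tail
budgets on the two branches: [FIN] on `NearAffine ε₁ ρ` at `(R_N, e⋆ + gN + τ_N)` with [TAIL](R_N, τ_N), and [FIN] on `¬ NearAffine ε₁ ρ` at
`(R_F, e⋆ + gF + τ_F)` with [TAIL](R_F, τ_F) ⟹ `AperiodicFrustratedLawGap` BY NAME. [new: junction] -/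
theorem aperiodicFrustratedLawGap_of_rangeCut_nearFar {r : ℝ} (hr : 0 < r) (ε₁ ρ : ℝ) {RN RF τN τF gN gF : ℝ}
    (hgN : 0 < gN) (hgF : 0 < gF)
    (hWN : TexturedWindowGapOn (NearAffine ε₁ ρ) r RN (eStar + gN + τN)) (hTN : SiteTailFloor RN τN)
    (hWF : TexturedWindowGapOn (fun μ => ¬ NearAffine ε₁ ρ μ) r RF (eStar + gF + τF)) (hTF : SiteTailFloor RF τF) :
    Summit.AtomisticToContinuum.Crystallization.Theses.FrustratedLawDichotomy.AperiodicFrustratedLawGap :=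
  aperiodicFrustratedLawGap_of_texturedLocalGap_nearFar hr ε₁ ρ hgN hgF
    (fun μ hμ hN hA hK => texturedLocalGapOn_of_rangeCut hr hWN hTN μ hμ hN hA hK)
    (fun μ hμ hN hA hK => texturedLocalGapOn_of_rangeCut hr hWF hTF μ hμ hN hA hK)

/-! ## §4. Monotonicity and the sharp constants at `R = 7` and `R = 13` -/

/-- a larger tail budget is still a tail floor. [new: bookkeeping] -/
theorem SiteTailFloor.mono {R τ τ' : ℝ} (h : SiteTailFloor R τ) (hτ : τ ≤ τ') : SiteTailFloor R τ' := fun ν hν => by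
  have := h ν hν
  linarith

/-- a window gap at threshold `a` is one at every `a' ≤ a`. [new: bookkeeping] -/
theorem TexturedWindowGapOn.of_le {K : Measure E3 → Prop} {r R a a' : ℝ} (h : TexturedWindowGapOn K r R a) (ha : a' ≤ a) :
    TexturedWindowGapOn K r R a' := fun S h0 hs hN hA hK T hT => ha.trans (h S h0 hs hN hA hK T hT)

/-- a window gap on a class holds on every smaller class. [new: bookkeeping] -/
theorem TexturedWindowGapOn.of_imp {K K' : Measure E3 → Prop} {r R a : ℝ} (h : TexturedWindowGapOn K r R a) (hKK : ∀ μ, K' μ → K μ) :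
    TexturedWindowGapOn K' r R a := fun S h0 hs hN hA hK T hT => h S h0 hs hN hA (hKK _ hK) T hT

/-- `tauSharp 7 ≤ 1/100` (`= 0.00780…`): the FAR tail budget at window radius `7`. [new: bookkeeping] -/
theorem tauSharp_seven_le : tauSharp 7 ≤ 1 / 100 := by
  unfold tauSharp
  norm_num

/-- `tauSharp 13 ≤ 3/2000` (`= 0.00106…`): the NEAR tail budget at window radius `13`. [new: bookkeeping] -/
theorem tauSharp_thirteen_le : tauSharp 13 ≤ 3 / 2000 := by
  unfold tauSharp
  norm_num

/-! ## §5. [TAIL] proved: the sitewise tail floor at the sharp constant -/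

/-- the truncated potential read along the norm is the `R`-ball indicator of the Lennard-Jones potential. [new: bookkeeping] -/
theorem truncLJ_norm_eq_indicator (R : ℝ) :
    (fun y : E3 => truncLJ R ‖y‖) = (ball (0 : E3) R).indicator fun y => lennardJones ‖y‖ := by
  funext y
  unfold truncLJ
  by_cases hy : ‖y‖ < R
  · rw [if_pos hy, indicator_of_mem (mem_ball_zero_iff.mpr hy)]
  · rw [if_neg hy, indicator_of_notMem fun h => hy (mem_ball_zero_iff.mp h)]

/-- ★ **[TAIL♯] THE SITEWISE TAIL FLOOR, PROVED**: for `R ≥ 1` and every rooted `7/10`-hard-core `ν = count|S`,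
`rootEnergy (truncLJ R) ν − tauSharp R ≤ rootEnergy V_LJ ν`.  The difference of the two root energies is `½ ∫_{S ∖ B(0,R)} V_LJ(‖y‖) d count`
(`integrable_lennardJones_of_isRootedHardCore`, `integral_sub`, `integral_indicator`); on the countable far set (`countable_of_separated`) that integral is the
series `Σ'_{y ∈ S, ‖y‖ ≥ R} V_LJ(dist 0 y)` (`setIntegral_countable`), which `abs_tsum_field_le_of_far_sharp_sevenTenths` (`z = 0`, `Rc = R`) bounds by
`2·tauSharp R` in absolute value. [folklore] -/
theorem siteTailFloorSharp : SiteTailFloorSharp := by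
  intro R hR ν hν
  have hLJ : Integrable (fun y : E3 => lennardJones ‖y‖) ν := integrable_lennardJones_of_isRootedHardCore (by norm_num : (0 : ℝ) < 7 / 10) hν
  obtain ⟨S, h0S, hsep, rfl⟩ := hν
  have htr : Integrable (fun y : E3 => truncLJ R ‖y‖) ((Measure.count : Measure E3).restrict S) := by
    rw [truncLJ_norm_eq_indicator]
    exact hLJ.indicator measurableSet_ball
  -- the difference of the integrands is the far-field indicator
  have hsub : (∫ y, lennardJones ‖y‖ ∂((Measure.count : Measure E3).restrict S)) - ∫ y, truncLJ R ‖y‖ ∂((Measure.count : Measure E3).restrict S) =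
      ∫ y, (ball (0 : E3) R)ᶜ.indicator (fun y : E3 => lennardJones ‖y‖) y ∂((Measure.count : Measure E3).restrict S) := by
    rw [← integral_sub hLJ htr]
    refine integral_congr_ae (ae_of_all _ fun y => ?_)
    show lennardJones ‖y‖ - truncLJ R ‖y‖ = (ball (0 : E3) R)ᶜ.indicator (fun y : E3 => lennardJones ‖y‖) y
    unfold truncLJ
    by_cases hy : ‖y‖ < R
    · rw [if_pos hy, indicator_of_notMem (Set.notMem_compl_iff.mpr (mem_ball_zero_iff.mpr hy)), sub_self]
    · rw [if_neg hy, indicator_of_mem (Set.mem_compl fun h => hy (mem_ball_zero_iff.mp h)), sub_zero]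
  -- hence the difference of the root energies is half the far-field integral over `count|(S ∖ B(0,R))`
  have hdiff : rootEnergy lennardJones ((Measure.count : Measure E3).restrict S) -
        rootEnergy (truncLJ R) ((Measure.count : Measure E3).restrict S) =
      (∫ y, lennardJones ‖y‖ ∂((Measure.count : Measure E3).restrict ((ball (0 : E3) R)ᶜ ∩ S))) / 2 := by
    rw [rootEnergy_def, rootEnergy_def, ← sub_div, hsub, integral_indicator measurableSet_ball.compl,
      Measure.restrict_restrict measurableSet_ball.compl]
  -- the far field is at least `-2·tauSharp R`
  have hfar : -(2 * tauSharp R) ≤ ∫ y, lennardJones ‖y‖ ∂((Measure.count : Measure E3).restrict ((ball (0 : E3) R)ᶜ ∩ S)) := by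
    have hYS : (ball (0 : E3) R)ᶜ ∩ S ⊆ S := inter_subset_right
    have hYc : ((ball (0 : E3) R)ᶜ ∩ S).Countable := (countable_of_separated (by norm_num : (0 : ℝ) < 7 / 10) hsep).mono hYS
    have hsepY : ∀ a ∈ (ball (0 : E3) R)ᶜ ∩ S, ∀ b ∈ (ball (0 : E3) R)ᶜ ∩ S, a ≠ b → (7 : ℝ) / 10 ≤ dist a b :=
      fun a ha b hb hab => hsep a ha.2 b hb.2 hab
    have hfarY : ∀ y ∈ (ball (0 : E3) R)ᶜ ∩ S, R ≤ dist (0 : E3) y := fun y hy => by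
      have h := hy.1
      rw [mem_compl_iff, mem_ball_zero_iff, not_lt] at h
      rwa [dist_comm, dist_zero_right]
    have hint : IntegrableOn (fun y : E3 => lennardJones ‖y‖) ((ball (0 : E3) R)ᶜ ∩ S) (Measure.count : Measure E3) :=
      hLJ.mono_measure (Measure.restrict_mono hYS le_rfl)
    have htsum : ∫ y, lennardJones ‖y‖ ∂((Measure.count : Measure E3).restrict ((ball (0 : E3) R)ᶜ ∩ S)) =
        ∑' y : ↥((ball (0 : E3) R)ᶜ ∩ S), lennardJones (dist (0 : E3) (y : E3)) := by
      rw [setIntegral_countable _ hYc hint]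
      refine tsum_congr fun y => ?_
      rw [count_real_singleton, one_smul, dist_comm, dist_zero_right]
    have habs := abs_tsum_field_le_of_far_sharp_sevenTenths hsepY (0 : E3) hR hfarY
    have h2 : 4000 / 1029 * R⁻¹ ^ 3 + 500 / 49 * R⁻¹ ^ 4 + 2 / 7 * R⁻¹ ^ 5 + 1 / 3 * R⁻¹ ^ 6 = 2 * tauSharp R := by
      unfold tauSharp
      ring
    rw [htsum]
    linarith [neg_abs_le (∑' y : ↥((ball (0 : E3) R)ᶜ ∩ S), lennardJones (dist (0 : E3) (y : E3)))]
  linarith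

/-- the two literal tail floors used below, now hypothesis-free. [new: bookkeeping] -/
theorem siteTailFloor_seven_thirteen : SiteTailFloor 7 (1 / 100) ∧ SiteTailFloor 13 (3 / 2000) :=
  ⟨(siteTailFloorSharp 7 (by norm_num)).mono tauSharp_seven_le, (siteTailFloorSharp 13 (by norm_num)).mono tauSharp_thirteen_le⟩

/-! ## §6. The doors with the tail discharged: only FINITE-WINDOW inequalities remain open -/

/-- ★ **THE RANGE-CUT DOOR, tail discharged** (class `⊤`, any `R ≥ 1`): [FIN](r, R, e⋆ + g + tauSharp R), `g > 0` ⟹ `AperiodicFrustratedLawGap`. [new: junction] -/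
theorem aperiodicFrustratedLawGap_of_windowGap {r R g : ℝ} (hr : 0 < r) (hR : 1 ≤ R) (hg : 0 < g)
    (hW : TexturedWindowGapOn (fun _ => True) r R (eStar + g + tauSharp R)) :
    Summit.AtomisticToContinuum.Crystallization.Theses.FrustratedLawDichotomy.AperiodicFrustratedLawGap :=
  aperiodicFrustratedLawGap_of_rangeCut hr hg hW (siteTailFloorSharp R hR)

/-- ★★ **THE LITERAL NEAR / FAR RANGE-CUT DOOR, tail discharged** (`R_N = 13`, budget `3/2000`; `R_F = 7`, budget `1/100`): [FIN] on `NearAffine ε₁ ρ` with the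
potential cut at `13` at threshold `e⋆ + gN + 3/2000` ∧ [FIN] off `NearAffine ε₁ ρ` with the cut at `7` at threshold `e⋆ + gF + 1/100`, `gN, gF > 0`
⟹ `AperiodicFrustratedLawGap` BY NAME — the ONLY open hypotheses are two finite-window inequalities.  (Desk: `gF ≈ 2·10⁻²` leaves `1.2·10⁻²` after the
budget; `gN ≈ 3.4·10⁻³` sits `1.05·10⁻³` under `κ_aff(fcc)`, of which the budget's slack over the enemy's own tail consumes `≈ 0.85·10⁻³`.) [new: junction] -/
theorem aperiodicFrustratedLawGap_of_rangeCut_nearFar_sharp {r : ℝ} (hr : 0 < r) (ε₁ ρ : ℝ) {gN gF : ℝ} (hgN : 0 < gN) (hgF : 0 < gF)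
    (hWN : TexturedWindowGapOn (NearAffine ε₁ ρ) r 13 (eStar + gN + 3 / 2000))
    (hWF : TexturedWindowGapOn (fun μ => ¬ NearAffine ε₁ ρ μ) r 7 (eStar + gF + 1 / 100)) :
    Summit.AtomisticToContinuum.Crystallization.Theses.FrustratedLawDichotomy.AperiodicFrustratedLawGap :=
  aperiodicFrustratedLawGap_of_rangeCut_nearFar hr ε₁ ρ hgN hgF hWN siteTailFloor_seven_thirteen.2 hWF siteTailFloor_seven_thirteen.1

/-! ## §7. Window locality of the truncated root energy -/

/-- **WINDOW LOCALITY (root term)**: the truncated root energy of `count|S` is that of `count|(S ∩ B(0,R))` — [FIN] reads the window only (the re-rooted terms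
read `S ∩ B(y, R)`, `|y| ≤ r`, and the weights read `S ∩ B̄(0, 2r)`, by the same token). [new: bookkeeping] -/
theorem rootEnergy_truncLJ_eq_inter_ball (R : ℝ) (S : Set E3) :
    rootEnergy (truncLJ R) ((Measure.count : Measure E3).restrict S) =
      rootEnergy (truncLJ R) ((Measure.count : Measure E3).restrict (S ∩ ball (0 : E3) R)) := by
  have key : ∀ S' : Set E3, ∫ y, truncLJ R ‖y‖ ∂((Measure.count : Measure E3).restrict S') =
      ∫ y, lennardJones ‖y‖ ∂((Measure.count : Measure E3).restrict (ball (0 : E3) R ∩ S')) := fun S' => by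
    rw [show (∫ y, truncLJ R ‖y‖ ∂((Measure.count : Measure E3).restrict S')) =
        ∫ y, (ball (0 : E3) R).indicator (fun y => lennardJones ‖y‖) y ∂((Measure.count : Measure E3).restrict S') from by
          rw [← truncLJ_norm_eq_indicator R],
      integral_indicator measurableSet_ball, Measure.restrict_restrict measurableSet_ball]
  rw [rootEnergy_def, rootEnergy_def, key S, key (S ∩ ball (0 : E3) R), inter_comm S, ← inter_assoc, inter_self]

end Summit.AtomisticToContinuum.Crystallization.Theorems.FrustratedLawDichotomyLFIRangeCut

end
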